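import Literature.MathematicalPhysics.QuantumFieldTheory.QCDOS
import HarnessLib

/-!
# Calibrated species renormalisations and mass-equicontinuity of lattice QCD families

Vocabulary on top of `QCDOS.lean` (`QCDRegularisation`, `QCDRegularisation.scheme`,
`qcdLatticeSchwinger`) for statements that quantify over ALL renormalised quark-mass tuples `m` of
one mass-independent regularisation `reg` at once (the `∃ reg, ∀ m, ∃ z shift T, …` shape of
`QCDOf`), where the species renormalisations `z_s(m,k) > 0`, `shift_s(m,k)` must be chosen as
FUNCTIONS of `m` and pinned by a renormalisation condition rather than left free.

* `QCDScheme.onePoint / twoPoint / connectedTwoPoint` — the lattice one- and two-point functions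
  of the renormalised smeared species fields `Φ_k^s(f)` (shorthands for `qcdLatticeSchwinger` at
  `n = 1, 2`) and the connected (truncated) two-point function.
* `timeSlab d a b = {x ∈ ℝ^d | a ≤ x⁰ ≤ b}`.
* `IsOnePointSubtracted reg z shift` — the additive counterterms are the ONE-POINT SUBTRACTION: every
  renormalised lattice one-point function vanishes (for the honest, translation-invariant torus
  functional this says `shift_s(m,k) = ⟨O_s(x)⟩_{k,m}`, the bare one-point expectation).
* `IsCalibratedAt reg f₀ z shift` — the multiplicative renormalisations are CALIBRATED on the
  reference pair `(Θf₀, f₀)`: whenever the connected two-point function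
  `⟨Φ^s(Θf₀) Φ^s(f₀)⟩_conn` of species `s` at step `k` and mass tuple `m` is a positive real, it
  equals `1` (a position-space wave-function renormalisation condition at a fixed PHYSICAL distance —
  the smeared fields read `f(a_k x)`, so the lattice distance `τ₀/a_k` grows as `a_k → 0`; for the
  honest functional the connected function scales as `z_s(m,k)²`, so the condition FIXES
  `z_s(m,k) = ⟨Φbare^s(Θf₀) Φbare^s(f₀)⟩_conn^{-1/2}`).
* `CalibratedSpeciesFamily reg` — the bundle: a physical distance `τ₀ > 0`, a real test function
  `f₀ ≠ 0` supported in the time slab `τ₀/2 ≤ x⁰ ≤ τ₀` (so `Θf₀` and `f₀` are time-separated and probe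
  separations in `[τ₀, 2τ₀]`), and data `z, shift : (Fin N_f → ℝ) → QCDField N_f → ℕ → ℝ` with
  `z > 0`, one-point subtracted and calibrated at `f₀`; `𝒞.scheme m = reg.scheme m (𝒞.z m) (𝒞.shift m)`.
* `IsMassEquicontinuous reg z shift` — the family of lattice `n`-point functions (`n ≥ 1`)
  `m ↦ qcdLatticeSchwinger (reg.scheme m (z m) (shift m)) k n σ f` is Lipschitz in `m` on every
  compact set of positive mass tuples, UNIFORMLY in the cutoff index `k` (the Arzelà–Ascoli
  modulus); API: the `ε–δ` form (`IsMassEquicontinuous.exists_forall_dist_lt`) and the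
  `LipschitzOnWith` form.
* `qcdSlabCorr`, `effectiveMass` — the zero-momentum (timeslice-summed) connected correlator of two
  gauge-invariant local lattice QCD observables on a torus and the two-timeslice effective mass
  `log (C t₁ / C t₂) / (t₂ − t₁)` (Montvay–Münster (7.28)–(7.32), `T = ∞` form).
* `QCDRegularisation.IsNonDecoupled reg` (2026-08-16, definition request of route
  `QuantumFields/DiagonalSpine`) — LATTICE NON-DECOUPLING in ratio form, locally uniform in the mass:
  on compacts of positive mass tuples, for every non-null species and every real `g` in a
  positive-time slab, the bare (`z ≡ 1`, `shift ≡ 0`) connected two-point function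
  `⟨Φ^s(Θg) Φ^s(τ_{j a_k} g)⟩_conn` under lattice-commensurate PHYSICAL time translations `j a_k ≤ T`
  stays above a fixed fraction `c > 0` of `⟨Φ^s(Θg) Φ^s(g)⟩_conn`, eventually in `k` (bounded physical
  channel masses); API: reduction to natural `T` (`isNonDecoupled_iff_nat`), the unfolded negation
  and the ratio-collapse / lattice-unit-gap criteria refuting it
  (`not_isNonDecoupled_iff`, `not_isNonDecoupled_of_ratio_collapse`,
  `not_isNonDecoupled_of_latticeUnitGap`), and the zero-test-function lemmas
  `QCDScheme.qcdLatticeSchwinger_eq_zero_of_eq_zero`, `onePoint_zero`, `twoPoint_zero_left/right`.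

Sources. Wave-function renormalisation fixed by a condition on the two-point function:
Montvay–Münster 1994, §1.6–§1.7, (1.234) and (1.251)–(1.253) (momentum-space form); its
position-space form at a fixed physical separation for composite lattice operators is the "X-space
scheme" of Giménez–Giusti–Guerriero–Lubicz–Martinelli–Petrarca–Reyes–Taglienti–Trevigne, Phys. Lett.
B 598 (2004) 227, §2 eq. (1) (`⟨O^X(x)O^X(0)⟩|_{x²=x₀²}` prescribed, `O^X = Z^X(x₀) O`).
Composite (meson) fields and their renormalisation in lattice QCD: Montvay–Münster §5.1. Timeslice
correlations and effective masses: Montvay–Münster §7.1, (7.28)–(7.32). Equicontinuity in a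
parameter uniformly in an index (Arzelà–Ascoli hypothesis): folklore.

Design notes. (i) `z`, `shift` are DATA constrained by identities, not closed formulas: the
identities are exactly the renormalisation conditions, they determine `z_s(m,k)` whenever the
calibrating connected function is positive and `shift_s(m,k)` always (given `z ≠ 0`) for the honest
lattice functional, and they avoid hard-coding junk branches; inhabiting `CalibratedSpeciesFamily reg`
for honest lattice QCD therefore INCLUDES the (elementary but unformalised) facts that torus
translation invariance makes the one-point subtraction work and that smeared correlators are
multilinear in the insertions. (ii) Positivity of the calibrating connected function is NOT built in
(it is reflection positivity of the Wilson-fermion transfer matrix plus non-degeneracy, a theorem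
about the honest functional); where it fails the calibration is silent, so statements wanting the
calibration to bite must assert that positivity. (iii) The mass tuples outside the open positive
orthant are immaterial to `QCDOf` but the predicates are stated for all `m` (simpler, never harder to
use; `IsMassEquicontinuous` restricts to compacts of positive tuples as requested by its users).
NOT here: any claim that honest lattice QCD admits a calibrated family or is mass-equicontinuous
(those are the cruxes these words were made to state).
-/

open scoped SchwartzMap
open MeasureTheory Filter Topology
open Literature.MathematicalPhysics.AQFT Literature.Probability.LatticeModels
  Literature.MathematicalPhysics.QuantumLattice

noncomputable section

namespace Literature.MathematicalPhysics.QuantumFieldTheory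

variable {Nf : ℕ}

/-! ### One- and two-point functions of a scheme -/

namespace QCDScheme

/-- The lattice **one-point function** `S₁^{s}(f) = ⟨Φ_k^s(f)⟩` of the renormalised smeared species
field `s` at step `k` of the scheme (`qcdLatticeSchwinger` at `n = 1`). [cite: MontvayMunster1994, §5.1] -/
def onePoint (sch : QCDScheme Nf) (k : ℕ) (s : QCDField Nf)
    (f : 𝓢(EuclideanSpace ℝ (Fin 4), ℝ)) : ℂ :=
  qcdLatticeSchwinger sch k 1 (fun _ => s) (fun _ => f)

/-- The lattice **two-point function** `S₂^{st}(g ⊗ f) = ⟨Φ_k^s(g) Φ_k^t(f)⟩` at step `k`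
(`qcdLatticeSchwinger` at `n = 2`). [cite: MontvayMunster1994, §5.1] -/
def twoPoint (sch : QCDScheme Nf) (k : ℕ) (s t : QCDField Nf)
    (g f : 𝓢(EuclideanSpace ℝ (Fin 4), ℝ)) : ℂ :=
  qcdLatticeSchwinger sch k 2 ![s, t] ![g, f]

/-- The **connected (truncated) two-point function**
`⟨Φ_k^s(g) Φ_k^t(f)⟩_conn = S₂^{st}(g ⊗ f) − S₁^{s}(g) S₁^{t}(f)`. [cite: GlimmJaffe1987, §6.1 (truncated functions)] -/
def connectedTwoPoint (sch : QCDScheme Nf) (k : ℕ) (s t : QCDField Nf)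
    (g f : 𝓢(EuclideanSpace ℝ (Fin 4), ℝ)) : ℂ :=
  sch.twoPoint k s t g f - sch.onePoint k s g * sch.onePoint k t f

/-- Unfolding `onePoint`. [folklore] -/
theorem onePoint_eq (sch : QCDScheme Nf) (k : ℕ) (s : QCDField Nf)
    (f : 𝓢(EuclideanSpace ℝ (Fin 4), ℝ)) :
    sch.onePoint k s f = qcdLatticeSchwinger sch k 1 (fun _ => s) (fun _ => f) := rfl

/-- Unfolding `twoPoint`. [folklore] -/
theorem twoPoint_eq (sch : QCDScheme Nf) (k : ℕ) (s t : QCDField Nf)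
    (g f : 𝓢(EuclideanSpace ℝ (Fin 4), ℝ)) :
    sch.twoPoint k s t g f = qcdLatticeSchwinger sch k 2 ![s, t] ![g, f] := rfl

/-- If both one-point functions vanish, the connected two-point function is the full one. [folklore] -/
theorem connectedTwoPoint_eq_twoPoint {sch : QCDScheme Nf} {k : ℕ} {s t : QCDField Nf}
    {g f : 𝓢(EuclideanSpace ℝ (Fin 4), ℝ)} (hg : sch.onePoint k s g = 0 ∨ sch.onePoint k t f = 0) :
    sch.connectedTwoPoint k s t g f = sch.twoPoint k s t g f := by
  rcases hg with h | h <;> simp [connectedTwoPoint, h]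

/-- With vanishing species renormalisations `z ≡ 0` every lattice `n`-point function with `n ≥ 1`
vanishes (the smeared fields carry the factor `z_s(k)`). [folklore] -/
theorem qcdLatticeSchwinger_eq_zero_of_z_eq_zero {sch : QCDScheme Nf} (hz : ∀ s k, sch.z s k = 0)
    (k : ℕ) {n : ℕ} (hn : n ≠ 0) (σ : Fin n → QCDField Nf)
    (f : Fin n → 𝓢(EuclideanSpace ℝ (Fin 4), ℝ)) : qcdLatticeSchwinger sch k n σ f = 0 := by
  obtain ⟨j, rfl⟩ := Nat.exists_eq_succ_of_ne_zero hn
  simp [qcdLatticeSchwinger, smearedInsertion, List.ofFn_succ, hz]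

/-- With `z ≡ 0` every one-point function vanishes. [folklore] -/
theorem onePoint_eq_zero_of_z_eq_zero {sch : QCDScheme Nf} (hz : ∀ s k, sch.z s k = 0) (k : ℕ)
    (s : QCDField Nf) (f : 𝓢(EuclideanSpace ℝ (Fin 4), ℝ)) : sch.onePoint k s f = 0 :=
  qcdLatticeSchwinger_eq_zero_of_z_eq_zero hz k one_ne_zero _ _

/-- With `z ≡ 0` every two-point function vanishes. [folklore] -/
theorem twoPoint_eq_zero_of_z_eq_zero {sch : QCDScheme Nf} (hz : ∀ s k, sch.z s k = 0) (k : ℕ)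
    (s t : QCDField Nf) (g f : 𝓢(EuclideanSpace ℝ (Fin 4), ℝ)) : sch.twoPoint k s t g f = 0 :=
  qcdLatticeSchwinger_eq_zero_of_z_eq_zero hz k two_ne_zero _ _

end QCDScheme

/-! ### Time slabs -/

section TimeSlab

variable (d : ℕ) [NeZero d]

/-- The closed **time slab** `{x ∈ ℝ^d | a ≤ x⁰ ≤ b}` (time = coordinate `0`). [folklore] -/
def timeSlab (a b : ℝ) : Set (EuclideanSpace ℝ (Fin d)) := {x | a ≤ x 0 ∧ x 0 ≤ b}

variable {d}

/-- Membership in a time slab. [folklore] -/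
@[simp] theorem mem_timeSlab {a b : ℝ} {x : EuclideanSpace ℝ (Fin d)} :
    x ∈ timeSlab d a b ↔ a ≤ x 0 ∧ x 0 ≤ b := Iff.rfl

variable (d) in
/-- Time slabs are closed. [folklore] -/
theorem isClosed_timeSlab (a b : ℝ) : IsClosed (timeSlab d a b) := by
  have hc : Continuous fun x : EuclideanSpace ℝ (Fin d) => x 0 := PiLp.continuous_apply 2 _ 0
  exact (isClosed_le continuous_const hc).inter (isClosed_le hc continuous_const)

/-- Time reflection maps the slab `[a, b]` onto the slab `[−b, −a]`. [folklore] -/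
theorem timeReflection_mem_timeSlab {a b : ℝ} {x : EuclideanSpace ℝ (Fin d)} :
    timeReflection d x ∈ timeSlab d (-b) (-a) ↔ x ∈ timeSlab d a b := by
  have h0 : timeReflection d x 0 = -x 0 := by simp
  simp only [mem_timeSlab, h0]
  constructor <;> rintro ⟨h₁, h₂⟩ <;> constructor <;> linarith

/-- The topological support of a time-reflected test function is the reflected support. [folklore] -/
theorem tsupport_thetaTest (f : 𝓢(EuclideanSpace ℝ (Fin d), ℝ)) :
    tsupport (thetaTest d f) = timeReflection d ⁻¹' tsupport (f : EuclideanSpace ℝ (Fin d) → ℝ) := by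
  have h : ⇑(thetaTest d f) = f ∘ timeReflection d := funext fun x => thetaTest_apply d f x
  rw [tsupport, tsupport, h, Function.support_comp_eq_preimage]
  exact ((timeReflection d).toHomeomorph.preimage_closure _).symm

/-- A test function supported in the slab `τ₀/2 ≤ x⁰ ≤ τ₀` has its time reflection supported in
`−τ₀ ≤ x⁰ ≤ −τ₀/2`: the pair `(Θf₀, f₀)` is time-separated by at least `τ₀` (and at most `2τ₀`). [folklore] -/
theorem tsupport_thetaTest_subset {τ₀ : ℝ} {f : 𝓢(EuclideanSpace ℝ (Fin d), ℝ)}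
    (hf : tsupport f ⊆ timeSlab d (τ₀ / 2) τ₀) :
    tsupport (thetaTest d f) ⊆ timeSlab d (-τ₀) (-(τ₀ / 2)) := by
  rw [tsupport_thetaTest]
  intro x hx
  have h := timeReflection_mem_timeSlab.2 (hf hx)
  rwa [timeReflection_timeReflection] at h

end TimeSlab

/-! ### Calibration predicates -/

/-- **One-point subtraction.** The additive counterterms `shift_s(m,k)` of the family
`m ↦ reg.scheme m (z m) (shift m)` subtract the one-point functions: every renormalised lattice
one-point function `⟨Φ_k^s(f)⟩` vanishes, for all mass tuples, species, steps and test functions.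
For the honest torus functional (translation invariant) this is `shift_s(m,k) = ⟨O_s(x)⟩_{k,m}`, the
bare one-point expectation — the standard additive renormalisation of a composite field by its
vacuum expectation value; it makes connected and full two-point functions coincide. [cite: MontvayMunster1994, §5.1] -/
def IsOnePointSubtracted (reg : QCDRegularisation Nf)
    (z shift : (Fin Nf → ℝ) → QCDField Nf → ℕ → ℝ) : Prop :=
  ∀ (m : Fin Nf → ℝ) (s : QCDField Nf) (k : ℕ) (f : 𝓢(EuclideanSpace ℝ (Fin 4), ℝ)),
    (reg.scheme m (z m) (shift m)).onePoint k s f = 0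

/-- **Calibration of the multiplicative renormalisations on the reference pair `(Θf₀, f₀)`.** For
every mass tuple `m`, species `s` and step `k`: IF the connected two-point function
`C = ⟨Φ_k^s(Θf₀) Φ_k^s(f₀)⟩_conn` of the family `reg.scheme m (z m) (shift m)` is a positive real
(`0 < Re C`, `Im C = 0`), THEN `C = 1`. Since the smeared field carries the factor `z_s(m,k)`, for the
honest functional `C = z_s(m,k)² C_bare` with `C_bare` independent of `(z, shift)`, and the condition
fixes `z_s(m,k) = C_bare^{-1/2}` exactly when `C_bare > 0` (reflection positivity gives `C_bare ≥ 0`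
when `f₀` lives at positive times) — a wave-function renormalisation condition imposed on the
two-point function (Montvay–Münster (1.251)–(1.253), momentum-space form), here in position space at
the fixed PHYSICAL separation of the pair (the smearing reads `f(a_k x)`) — the smeared analogue of the
coordinate-space ("X-space") condition `⟨O^X(x) O^X(0)⟩|_{x² = x₀²} = const`, `O^X = Z^X(x₀) O`, of
Giménez et al. (normalised there to the free continuum value, here to `1`). Where the proviso fails
the condition is silent. [cite: MontvayMunster1994, §1.7 (1.251)–(1.253)] [cite: GimenezEtAl2004, §2 eq. (1)] -/
def IsCalibratedAt (reg : QCDRegularisation Nf) (f₀ : 𝓢(EuclideanSpace ℝ (Fin 4), ℝ))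
    (z shift : (Fin Nf → ℝ) → QCDField Nf → ℕ → ℝ) : Prop :=
  ∀ (m : Fin Nf → ℝ) (s : QCDField Nf) (k : ℕ),
    0 < ((reg.scheme m (z m) (shift m)).connectedTwoPoint k s s (thetaTest 4 f₀) f₀).re →
      ((reg.scheme m (z m) (shift m)).connectedTwoPoint k s s (thetaTest 4 f₀) f₀).im = 0 →
        (reg.scheme m (z m) (shift m)).connectedTwoPoint k s s (thetaTest 4 f₀) f₀ = 1

/-! ### Calibrated species families -/

/-- **A calibrated family of species renormalisations** for the mass-independent regularisation
`reg` (the renormalisation CONVENTION under which "uniform bounds in `k`, locally uniformly in the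
quark masses `m`" is a meaningful demand): a physical calibration distance `τ₀ > 0`; a real test
function `f₀ ≠ 0` supported in the time slab `τ₀/2 ≤ x⁰ ≤ τ₀`, so that the reference pair
`(Θf₀, f₀)` is time-separated and probes Euclidean-time separations in `[τ₀, 2τ₀]` at EVERY step `k`
(physical units: the lattice fields are smeared with `f(a_k x)`); and species renormalisations
`z_s(m,k) > 0`, `shift_s(m,k)` as functions of the renormalised mass tuple `m`, subject to the
one-point subtraction (`IsOnePointSubtracted`) and the two-point calibration at `f₀`
(`IsCalibratedAt`): `⟨Φ^s(Θf₀) Φ^s(f₀)⟩_conn = 1` whenever it is a positive real. The scheme realising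
the tuple `m` is `𝒞.scheme m = reg.scheme m (𝒞.z m) (𝒞.shift m)`. [cite: MontvayMunster1994, §1.7 (1.251)–(1.253) and §5.1] [cite: GimenezEtAl2004, §2 eq. (1)] -/
structure CalibratedSpeciesFamily (reg : QCDRegularisation Nf) where
  /-- the physical calibration distance -/
  τ₀ : ℝ
  τ₀_pos : 0 < τ₀
  /-- the reference test function (real, at positive times) -/
  f₀ : 𝓢(EuclideanSpace ℝ (Fin 4), ℝ)
  f₀_ne_zero : f₀ ≠ 0
  /-- `f₀` lives in the time slab `τ₀/2 ≤ x⁰ ≤ τ₀` -/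
  tsupport_f₀ : tsupport f₀ ⊆ timeSlab 4 (τ₀ / 2) τ₀
  /-- multiplicative species renormalisations `z_s(m,k)` -/
  z : (Fin Nf → ℝ) → QCDField Nf → ℕ → ℝ
  /-- additive counterterms `shift_s(m,k)` -/
  shift : (Fin Nf → ℝ) → QCDField Nf → ℕ → ℝ
  z_pos : ∀ m s k, 0 < z m s k
  /-- the counterterms subtract the one-point functions -/
  onePointSubtracted : IsOnePointSubtracted reg z shift
  /-- the multiplicative renormalisations are calibrated on `(Θf₀, f₀)` -/
  calibrated : IsCalibratedAt reg f₀ z shift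

namespace CalibratedSpeciesFamily

variable {reg : QCDRegularisation Nf}

/-- The scheme of the calibrated family realising the renormalised mass tuple `m`. [folklore] -/
def scheme (𝒞 : CalibratedSpeciesFamily reg) (m : Fin Nf → ℝ) : QCDScheme Nf :=
  reg.scheme m (𝒞.z m) (𝒞.shift m)

/-- The spacings of `𝒞.scheme m`. [folklore] -/
@[simp] theorem scheme_a (𝒞 : CalibratedSpeciesFamily reg) (m : Fin Nf → ℝ) :
    (𝒞.scheme m).a = reg.a := rfl

/-- The inverse bare couplings of `𝒞.scheme m`. [folklore] -/
@[simp] theorem scheme_β (𝒞 : CalibratedSpeciesFamily reg) (m : Fin Nf → ℝ) :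
    (𝒞.scheme m).β = reg.β := rfl

/-- The torus half-sides of `𝒞.scheme m`. [folklore] -/
@[simp] theorem scheme_L (𝒞 : CalibratedSpeciesFamily reg) (m : Fin Nf → ℝ) :
    (𝒞.scheme m).L = reg.L := rfl

/-- The species renormalisations at `m` of `𝒞.scheme m`. [folklore] -/
@[simp] theorem scheme_z (𝒞 : CalibratedSpeciesFamily reg) (m : Fin Nf → ℝ) :
    (𝒞.scheme m).z = 𝒞.z m := rfl

/-- The counterterms at `m` of `𝒞.scheme m`. [folklore] -/
@[simp] theorem scheme_shift (𝒞 : CalibratedSpeciesFamily reg) (m : Fin Nf → ℝ) :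
    (𝒞.scheme m).shift = 𝒞.shift m := rfl

/-- The bare-mass trajectory of `𝒞.scheme m`. [folklore] -/
@[simp] theorem scheme_mq (𝒞 : CalibratedSpeciesFamily reg) (m : Fin Nf → ℝ) (f : Fin Nf) (k : ℕ) :
    (𝒞.scheme m).mq f k = reg.mcrit k + reg.a k * m f / reg.Zm k := rfl

/-- The torus side of `𝒞.scheme m`. [folklore] -/
@[simp] theorem scheme_side (𝒞 : CalibratedSpeciesFamily reg) (m : Fin Nf → ℝ) (k : ℕ) :
    (𝒞.scheme m).side k = 2 * reg.L k + 1 := rfl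

/-- `𝒞.scheme m` is literally `reg.scheme m (𝒞.z m) (𝒞.shift m)`. [folklore] -/
theorem scheme_eq (𝒞 : CalibratedSpeciesFamily reg) (m : Fin Nf → ℝ) :
    𝒞.scheme m = reg.scheme m (𝒞.z m) (𝒞.shift m) := rfl

/-- The species renormalisations of a calibrated family never vanish. [folklore] -/
theorem z_ne_zero (𝒞 : CalibratedSpeciesFamily reg) (m : Fin Nf → ℝ) (s : QCDField Nf) (k : ℕ) :
    𝒞.z m s k ≠ 0 := (𝒞.z_pos m s k).ne'

/-- All renormalised one-point functions of a calibrated family vanish. [folklore] -/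
theorem onePoint_eq_zero (𝒞 : CalibratedSpeciesFamily reg) (m : Fin Nf → ℝ) (s : QCDField Nf) (k : ℕ)
    (f : 𝓢(EuclideanSpace ℝ (Fin 4), ℝ)) : (𝒞.scheme m).onePoint k s f = 0 :=
  𝒞.onePointSubtracted m s k f

/-- For a calibrated family connected and full two-point functions agree. [folklore] -/
theorem connectedTwoPoint_eq (𝒞 : CalibratedSpeciesFamily reg) (m : Fin Nf → ℝ) (s t : QCDField Nf)
    (k : ℕ) (g f : 𝓢(EuclideanSpace ℝ (Fin 4), ℝ)) :
    (𝒞.scheme m).connectedTwoPoint k s t g f = (𝒞.scheme m).twoPoint k s t g f :=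
  QCDScheme.connectedTwoPoint_eq_twoPoint (Or.inl (𝒞.onePoint_eq_zero m s k g))

/-- **The calibration identity**: whenever the calibrating two-point function
`⟨Φ_k^s(Θf₀) Φ_k^s(f₀)⟩` at mass tuple `m` is a positive real, it equals `1`. [cite: MontvayMunster1994, §1.7 (1.251)–(1.253)] -/
theorem twoPoint_eq_one (𝒞 : CalibratedSpeciesFamily reg) (m : Fin Nf → ℝ) (s : QCDField Nf) (k : ℕ)
    (hre : 0 < ((𝒞.scheme m).twoPoint k s s (thetaTest 4 𝒞.f₀) 𝒞.f₀).re)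
    (him : ((𝒞.scheme m).twoPoint k s s (thetaTest 4 𝒞.f₀) 𝒞.f₀).im = 0) :
    (𝒞.scheme m).twoPoint k s s (thetaTest 4 𝒞.f₀) 𝒞.f₀ = 1 := by
  have h := 𝒞.calibrated m s k
  rw [show reg.scheme m (𝒞.z m) (𝒞.shift m) = 𝒞.scheme m from rfl, 𝒞.connectedTwoPoint_eq] at h
  exact h hre him

/-- The reflected reference function lives at negative times `−τ₀ ≤ x⁰ ≤ −τ₀/2`. [folklore] -/
theorem tsupport_thetaTest_f₀ (𝒞 : CalibratedSpeciesFamily reg) :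
    tsupport (thetaTest 4 𝒞.f₀) ⊆ timeSlab 4 (-𝒞.τ₀) (-(𝒞.τ₀ / 2)) :=
  tsupport_thetaTest_subset 𝒞.tsupport_f₀

/-- The supports of the reference pair are disjoint (indeed separated by `τ₀` in time). [folklore] -/
theorem disjoint_tsupport (𝒞 : CalibratedSpeciesFamily reg) :
    Disjoint (tsupport (thetaTest 4 𝒞.f₀)) (tsupport 𝒞.f₀) := by
  refine Set.disjoint_left.2 fun x hx hx' => ?_
  have h₁ := (mem_timeSlab.1 (𝒞.tsupport_thetaTest_f₀ hx)).2
  have h₂ := (mem_timeSlab.1 (𝒞.tsupport_f₀ hx')).1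
  linarith [𝒞.τ₀_pos]

end CalibratedSpeciesFamily

/-! ### Mass-equicontinuity -/

/-- **Mass-equicontinuity of a family of lattice QCD functionals** (the Arzelà–Ascoli modulus in the
quark mass): for every arity `n ≥ 1`, species string `σ`, real test functions `f` and every compact set
`K` of POSITIVE mass tuples there is ONE constant `C` such that for ALL steps `k` and all
`m, m' ∈ K`,
`‖S_k(m; n, σ, f) − S_k(m'; n, σ, f)‖ ≤ C ‖m − m'‖`, where
`S_k(m; n, σ, f) = qcdLatticeSchwinger (reg.scheme m (z m) (shift m)) k n σ f` — Lipschitz in the mass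
on compacts, uniformly in the cutoff. Together with pointwise bounds uniform in `k` this is the
hypothesis under which one strictly increasing subsequence of `k` serves every `m` at once. As in
`IsQCDAlong`, arity `n = 0` is excluded: the `0`-point function is the normalisation quotient `Z/Z`,
blind to `z`, `shift` and `f` (and `𝔖₀ = 1` for OS data by E0). [folklore] -/
def IsMassEquicontinuous (reg : QCDRegularisation Nf)
    (z shift : (Fin Nf → ℝ) → QCDField Nf → ℕ → ℝ) : Prop :=
  ∀ (n : ℕ), n ≠ 0 → ∀ (σ : Fin n → QCDField Nf) (f : Fin n → 𝓢(EuclideanSpace ℝ (Fin 4), ℝ))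
    (K : Set (Fin Nf → ℝ)), IsCompact K → K ⊆ {m | ∀ fl, 0 < m fl} →
      ∃ C : ℝ, ∀ k : ℕ, ∀ m ∈ K, ∀ m' ∈ K,
        ‖qcdLatticeSchwinger (reg.scheme m (z m) (shift m)) k n σ f -
            qcdLatticeSchwinger (reg.scheme m' (z m') (shift m')) k n σ f‖ ≤ C * ‖m - m'‖

namespace IsMassEquicontinuous

variable {reg : QCDRegularisation Nf} {z shift : (Fin Nf → ℝ) → QCDField Nf → ℕ → ℝ}

/-- The Lipschitz constant may be taken non-negative. [folklore] -/
theorem exists_nonneg (h : IsMassEquicontinuous reg z shift) {n : ℕ} (hn : n ≠ 0) (σ : Fin n → QCDField Nf)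
    (f : Fin n → 𝓢(EuclideanSpace ℝ (Fin 4), ℝ)) {K : Set (Fin Nf → ℝ)} (hK : IsCompact K)
    (hpos : K ⊆ {m | ∀ fl, 0 < m fl}) :
    ∃ C : ℝ, 0 ≤ C ∧ ∀ k : ℕ, ∀ m ∈ K, ∀ m' ∈ K,
      ‖qcdLatticeSchwinger (reg.scheme m (z m) (shift m)) k n σ f -
          qcdLatticeSchwinger (reg.scheme m' (z m') (shift m')) k n σ f‖ ≤ C * ‖m - m'‖ := by
  obtain ⟨C, hC⟩ := h n hn σ f K hK hpos
  refine ⟨max C 0, le_max_right _ _, fun k m hm m' hm' => (hC k m hm m' hm').trans ?_⟩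
  exact mul_le_mul_of_nonneg_right (le_max_left _ _) (norm_nonneg _)

/-- **`ε–δ` form** (the equicontinuity hypothesis of a diagonal/Arzelà–Ascoli lemma): on each compact
set of positive mass tuples, for every `ε > 0` one `δ > 0` works for all steps `k`. [folklore] -/
theorem exists_forall_dist_lt (h : IsMassEquicontinuous reg z shift) {n : ℕ} (hn : n ≠ 0) (σ : Fin n → QCDField Nf)
    (f : Fin n → 𝓢(EuclideanSpace ℝ (Fin 4), ℝ)) {K : Set (Fin Nf → ℝ)} (hK : IsCompact K)
    (hpos : K ⊆ {m | ∀ fl, 0 < m fl}) {ε : ℝ} (hε : 0 < ε) :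
    ∃ δ > 0, ∀ k : ℕ, ∀ m ∈ K, ∀ m' ∈ K, dist m m' < δ →
      ‖qcdLatticeSchwinger (reg.scheme m (z m) (shift m)) k n σ f -
          qcdLatticeSchwinger (reg.scheme m' (z m') (shift m')) k n σ f‖ < ε := by
  obtain ⟨C, hC0, hC⟩ := h.exists_nonneg hn σ f hK hpos
  refine ⟨ε / (C + 1), div_pos hε (by linarith), fun k m hm m' hm' hd => ?_⟩
  have hC1 : 0 < C + 1 := by linarith
  calc ‖qcdLatticeSchwinger (reg.scheme m (z m) (shift m)) k n σ f -
          qcdLatticeSchwinger (reg.scheme m' (z m') (shift m')) k n σ f‖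
      ≤ C * ‖m - m'‖ := hC k m hm m' hm'
    _ ≤ (C + 1) * ‖m - m'‖ := mul_le_mul_of_nonneg_right (by linarith) (norm_nonneg _)
    _ < (C + 1) * (ε / (C + 1)) := by
        refine mul_lt_mul_of_pos_left ?_ hC1
        rwa [← dist_eq_norm]
    _ = ε := mul_div_cancel₀ ε hC1.ne'

/-- **Lipschitz form**: one `LipschitzOnWith` constant on `K` serves every step `k`. [folklore] -/
theorem exists_lipschitzOnWith (h : IsMassEquicontinuous reg z shift) {n : ℕ} (hn : n ≠ 0) (σ : Fin n → QCDField Nf)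
    (f : Fin n → 𝓢(EuclideanSpace ℝ (Fin 4), ℝ)) {K : Set (Fin Nf → ℝ)} (hK : IsCompact K)
    (hpos : K ⊆ {m | ∀ fl, 0 < m fl}) :
    ∃ C : NNReal, ∀ k : ℕ,
      LipschitzOnWith C (fun m => qcdLatticeSchwinger (reg.scheme m (z m) (shift m)) k n σ f) K := by
  obtain ⟨C, hC0, hC⟩ := h.exists_nonneg hn σ f hK hpos
  refine ⟨⟨C, hC0⟩, fun k => LipschitzOnWith.of_dist_le_mul fun m hm m' hm' => ?_⟩
  rw [dist_eq_norm, dist_eq_norm]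
  exact hC k m hm m' hm'

end IsMassEquicontinuous

/-- Mass-equicontinuity of a calibrated family: `IsMassEquicontinuous reg 𝒞.z 𝒞.shift`. [folklore] -/
abbrev CalibratedSpeciesFamily.IsMassEquicontinuous {reg : QCDRegularisation Nf}
    (𝒞 : CalibratedSpeciesFamily reg) : Prop :=
  QuantumFieldTheory.IsMassEquicontinuous reg 𝒞.z 𝒞.shift

/-- Without quark masses (`N_f = 0`, a single mass tuple) every family is mass-equicontinuous:
non-vacuity of the predicate, and a reminder that its content is the dependence on `m`. [folklore] -/
theorem isMassEquicontinuous_of_isEmpty [IsEmpty (Fin Nf)] (reg : QCDRegularisation Nf)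
    (z shift : (Fin Nf → ℝ) → QCDField Nf → ℕ → ℝ) : IsMassEquicontinuous reg z shift := by
  intro n _ σ f K _ _
  refine ⟨0, fun k m _ m' _ => ?_⟩
  have hm : m = m' := Subsingleton.elim _ _
  subst hm
  simp

/-- **Non-vacuity for every regularisation**: a family with vanishing species renormalisations
`z ≡ 0` has identically vanishing `n`-point functions for `n ≥ 1`, hence is mass-equicontinuous (with
constant `0`) — the predicate's content is entirely in the honest `z > 0` families. [folklore] -/
theorem isMassEquicontinuous_of_z_eq_zero (reg : QCDRegularisation Nf)
    {z : (Fin Nf → ℝ) → QCDField Nf → ℕ → ℝ} (hz : ∀ m s k, z m s k = 0)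
    (shift : (Fin Nf → ℝ) → QCDField Nf → ℕ → ℝ) : IsMassEquicontinuous reg z shift := by
  intro n hn σ f K _ _
  refine ⟨0, fun k m _ m' _ => ?_⟩
  rw [QCDScheme.qcdLatticeSchwinger_eq_zero_of_z_eq_zero (hz m) k hn,
    QCDScheme.qcdLatticeSchwinger_eq_zero_of_z_eq_zero (hz m') k hn]
  simp

/-! ### Timeslice-summed correlators and effective masses -/

/-- **Zero-momentum (timeslice-summed) connected correlator** of two gauge-invariant local lattice
QCD observables on the torus of side `2S+1` at inverse bare coupling `β` and bare masses `m_f`: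
`C_{A,B}(t) = ∑_{y ∈ {−S,…,S}³} (⟨A(0) · B(t, y)⟩ − ⟨A(0)⟩⟨B(t, y)⟩)`, `B` translated to Euclidean
time `t` and spatial position `y` (Montvay–Münster (7.28)–(7.29): timeslice correlations, from which
masses are extracted); the `y = 0` summand is the time-only translate of `qcdLatticeConnectedCorr β (2S+1) m_f A B t`.
No reflection is applied to `A`: the reflection-positive diagonal case is `B = ΘA` supplied by the user. [cite: MontvayMunster1994, §7.1 (7.28)–(7.29)] -/
def qcdSlabCorr {R R' : ℕ} (β : ℝ) (S : ℕ) (mq : Fin Nf → ℝ)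
    (A : QCDLatticeObservable Nf R) (B : QCDLatticeObservable Nf R') (t : ℕ) : ℂ :=
  ∑ y ∈ box 3 S,
    (qcdTorusExpect β (2 * S + 1) mq
        (fun U => A.onTorus (2 * S + 1) 0 U * B.onTorus (2 * S + 1) (Fin.cons (t : ℤ) y) U) -
      qcdTorusExpect β (2 * S + 1) mq (A.onTorus (2 * S + 1) 0) *
        qcdTorusExpect β (2 * S + 1) mq (B.onTorus (2 * S + 1) (Fin.cons (t : ℤ) y)))

/-- The **two-timeslice effective mass** of a correlator `C` between lattice times `t₁` and `t₂`:
`m_eff(t₁, t₂) = log (C t₁ / C t₂) / (t₂ − t₁)` — the unique `m` with `C t₂ = C t₁ e^{−m (t₂ − t₁)}`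
when `C t₁, C t₂ > 0` (Montvay–Münster (7.30)–(7.32) in the limit of infinite time extent `T`, where
the periodic image term drops). Junk value when `t₁ = t₂` or `C t₂ = 0` (division by zero). [cite: MontvayMunster1994, §7.1 (7.30)–(7.32)] -/
def effectiveMass (C : ℕ → ℝ) (t₁ t₂ : ℕ) : ℝ :=
  Real.log (C t₁ / C t₂) / ((t₂ : ℝ) - t₁)

/-- For a pure exponential `C t = c e^{−m t}` (`c > 0`) the effective mass between any two distinct
times is `m`. [cite: MontvayMunster1994, §7.1 (7.29)–(7.31)] -/
theorem effectiveMass_exp {c m : ℝ} (hc : 0 < c) {t₁ t₂ : ℕ} (ht : t₁ ≠ t₂) :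
    effectiveMass (fun t => c * Real.exp (-m * t)) t₁ t₂ = m := by
  have hne : (t₂ : ℝ) - t₁ ≠ 0 := sub_ne_zero.2 (by exact_mod_cast (Ne.symm ht))
  unfold effectiveMass
  rw [mul_div_mul_left _ _ hc.ne', ← Real.exp_sub, Real.log_exp]
  field_simp
  ring

/-! ### Lattice non-decoupling of a mass-independent regularisation -/

namespace QCDScheme

/-- Smearing against the zero test function gives the zero Grassmann element. [folklore] -/
@[simp] theorem smearedInsertion_zero (sch : QCDScheme Nf) (k : ℕ)
    (U : GaugeConfig 4 (sch.side k) (Matrix.specialUnitaryGroup (Fin 3) ℂ)) (s : QCDField Nf) :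
    smearedInsertion sch k U s 0 = 0 := by
  simp [smearedInsertion]

/-- A lattice `n`-point function with a zero test function among its arguments vanishes (the
integrand contains the factor `Φ_k^s(0) = 0`). [folklore] -/
theorem qcdLatticeSchwinger_eq_zero_of_eq_zero (sch : QCDScheme Nf) (k : ℕ) {n : ℕ}
    (σ : Fin n → QCDField Nf) {f : Fin n → 𝓢(EuclideanSpace ℝ (Fin 4), ℝ)} {i : Fin n}
    (hi : f i = 0) : qcdLatticeSchwinger sch k n σ f = 0 := by
  have h0 : ∀ U : GaugeConfig 4 (sch.side k) (Matrix.specialUnitaryGroup (Fin 3) ℂ),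
      ((List.ofFn fun i => smearedInsertion sch k U (σ i) (f i)).prod) = 0 := fun U =>
    List.prod_eq_zero ((List.mem_ofFn' _ _).2 ⟨i, by simp only [hi, smearedInsertion_zero]⟩)
  simp [qcdLatticeSchwinger, h0]

/-- The one-point function of the zero test function vanishes. [folklore] -/
@[simp] theorem onePoint_zero (sch : QCDScheme Nf) (k : ℕ) (s : QCDField Nf) :
    sch.onePoint k s 0 = 0 :=
  sch.qcdLatticeSchwinger_eq_zero_of_eq_zero k _ (i := 0) rfl

/-- A two-point function with the zero test function on the left vanishes. [folklore] -/
@[simp] theorem twoPoint_zero_left (sch : QCDScheme Nf) (k : ℕ) (s t : QCDField Nf)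
    (f : 𝓢(EuclideanSpace ℝ (Fin 4), ℝ)) : sch.twoPoint k s t 0 f = 0 :=
  sch.qcdLatticeSchwinger_eq_zero_of_eq_zero k _ (i := 0) rfl

/-- A two-point function with the zero test function on the right vanishes. [folklore] -/
@[simp] theorem twoPoint_zero_right (sch : QCDScheme Nf) (k : ℕ) (s t : QCDField Nf)
    (g : 𝓢(EuclideanSpace ℝ (Fin 4), ℝ)) : sch.twoPoint k s t g 0 = 0 :=
  sch.qcdLatticeSchwinger_eq_zero_of_eq_zero k _ (i := 1) rfl

/-- A connected two-point function with the zero test function on the left vanishes. [folklore] -/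
@[simp] theorem connectedTwoPoint_zero_left (sch : QCDScheme Nf) (k : ℕ) (s t : QCDField Nf)
    (f : 𝓢(EuclideanSpace ℝ (Fin 4), ℝ)) : sch.connectedTwoPoint k s t 0 f = 0 := by
  simp [connectedTwoPoint]

/-- A connected two-point function with the zero test function on the right vanishes. [folklore] -/
@[simp] theorem connectedTwoPoint_zero_right (sch : QCDScheme Nf) (k : ℕ) (s t : QCDField Nf)
    (g : 𝓢(EuclideanSpace ℝ (Fin 4), ℝ)) : sch.connectedTwoPoint k s t g 0 = 0 := by
  simp [connectedTwoPoint]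

end QCDScheme

namespace QCDRegularisation

/-- **Lattice non-decoupling of a mass-independent regularisation** (ratio form, locally uniform in
the quark masses; harness-coined, it is hypothesis H4 of `DiagonalSpine.CalibratedTightness` and the
last conjunct of `DiagonalSpine.LightQuarkGap`, verbatim). For every compact set `K` of POSITIVE mass
tuples, every non-null species `s` (`s ≠ pseudoIm fl fl`), all `t₁ > 0`, `t₂`, every real test
function `g` supported in the time slab `t₁ ≤ x⁰ ≤ t₂` and every physical time `T` there is ONE `c > 0`
such that for all large `k`, all `m ∈ K` and all lattice-commensurate physical time translations
`j a_k ≤ T` (`j ∈ ℕ`):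
`c ‖C_k(m; Θg, g)‖ ≤ ‖C_k(m; Θg, τ_{j a_k} g)‖`,
where `C_k(m; h, f) = ⟨Φ_k^s(h) Φ_k^s(f)⟩_conn` (`QCDScheme.connectedTwoPoint`) is the connected two-point
function of the BARE scheme `reg.scheme m 1 0` (`z ≡ 1`, `shift ≡ 0`), `Θ = thetaTest 4`,
`τ_t = timeShiftTest 4 t`. Reading: by time-translation invariance a connected timeslice correlator at
lattice time distance `t` decays like `e^{−μt}`, `μ` the channel mass in LATTICE units, from which
masses are read off (Montvay–Münster (7.27)–(7.32); spectrally `⟨v, e^{−tH} v⟩`, Glimm–Jaffe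
Thm 6.1.3), so a physical translation `T = j a_k` costs `e^{−(μ/a_k) T}`: the condition says that the
physical channel masses `μ_s(k, m)/a_k` of all non-null species stay BOUNDED as `a_k → 0`, locally
uniformly in `m` — "no species' bare connected two-point function dies under a lattice-commensurate
physical time translation, `k`-uniformly". It FAILS for decoupled regularisations (channel masses
`≥ μ₀ > 0` in lattice units, e.g. `m_crit` parked deep in the hopping-expansion domain: the ratio is
`≤ C e^{−μ₀ T/a_k} → 0`, `not_isNonDecoupled_of_latticeUnitGap`), which `HasMassScaling`, asymptotic
scaling and the lattice gap do not exclude since they leave `m_crit` free. Design: ratio form (weaker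
than an explicit `e^{−MT}` law, same exclusion of the decoupled class); norms, not real parts (no
reflection-positivity sign claim for the finite-volume functional); the bare scheme `(z, shift) = (1, 0)`
(for the honest functional the ratio is `(z, shift)`-independent). [cite: MontvayMunster1994, §7.1 (7.27)–(7.32)] [cite: GlimmJaffeQP1987, §6.1 Thm 6.1.3] -/
def IsNonDecoupled (reg : QCDRegularisation Nf) : Prop :=
  ∀ K : Set (Fin Nf → ℝ), IsCompact K → K ⊆ {m | ∀ fl, 0 < m fl} → ∀ s : QCDField Nf,
    (∀ fl, s ≠ QCDField.pseudoIm fl fl) → ∀ (t₁ t₂ : ℝ), 0 < t₁ →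
      ∀ g : 𝓢(EuclideanSpace ℝ (Fin 4), ℝ), tsupport g ⊆ timeSlab 4 t₁ t₂ → ∀ T : ℝ,
        ∃ c > 0, ∀ᶠ k in atTop, ∀ m ∈ K, ∀ j : ℕ, (j : ℝ) * reg.a k ≤ T →
          c * ‖(reg.scheme m 1 0).connectedTwoPoint k s s (thetaTest 4 g) g‖ ≤
            ‖(reg.scheme m 1 0).connectedTwoPoint k s s (thetaTest 4 g)
              (timeShiftTest 4 ((j : ℝ) * reg.a k) g)‖

/-- **Monotonicity in the physical time**: natural time bounds suffice. The clause for `T` follows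
from the clause for any `T' ≥ T` (it has fewer translations `j a_k ≤ T` to serve), and `T ≤ ⌈T⌉₊`;
so `IsNonDecoupled` is equivalent to its restriction to `T ∈ ℕ`. [folklore] -/
theorem isNonDecoupled_iff_nat (reg : QCDRegularisation Nf) :
    reg.IsNonDecoupled ↔
      ∀ K : Set (Fin Nf → ℝ), IsCompact K → K ⊆ {m | ∀ fl, 0 < m fl} → ∀ s : QCDField Nf,
        (∀ fl, s ≠ QCDField.pseudoIm fl fl) → ∀ (t₁ t₂ : ℝ), 0 < t₁ →
          ∀ g : 𝓢(EuclideanSpace ℝ (Fin 4), ℝ), tsupport g ⊆ timeSlab 4 t₁ t₂ → ∀ N : ℕ,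
            ∃ c > 0, ∀ᶠ k in atTop, ∀ m ∈ K, ∀ j : ℕ, (j : ℝ) * reg.a k ≤ N →
              c * ‖(reg.scheme m 1 0).connectedTwoPoint k s s (thetaTest 4 g) g‖ ≤
                ‖(reg.scheme m 1 0).connectedTwoPoint k s s (thetaTest 4 g)
                  (timeShiftTest 4 ((j : ℝ) * reg.a k) g)‖ := by
  refine ⟨fun h K hK hpos s hs t₁ t₂ ht₁ g hg N => h K hK hpos s hs t₁ t₂ ht₁ g hg N,
    fun h K hK hpos s hs t₁ t₂ ht₁ g hg T => ?_⟩
  obtain ⟨c, hc, h'⟩ := h K hK hpos s hs t₁ t₂ ht₁ g hg ⌈T⌉₊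
  exact ⟨c, hc, h'.mono fun k hk m hm j hj => hk m hm j (hj.trans (Nat.le_ceil T))⟩

/-- The non-decoupling inequality is automatic for the zero test function (both sides vanish, any
`c` works): the content of `IsNonDecoupled` is in `g ≠ 0`. [folklore] -/
theorem isNonDecoupled_clause_zero (reg : QCDRegularisation Nf) (K : Set (Fin Nf → ℝ))
    (s : QCDField Nf) (T : ℝ) :
    ∃ c > (0 : ℝ), ∀ᶠ k in atTop, ∀ m ∈ K, ∀ j : ℕ, (j : ℝ) * reg.a k ≤ T →
      c * ‖(reg.scheme m 1 0).connectedTwoPoint k s s (thetaTest 4 0) 0‖ ≤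
        ‖(reg.scheme m 1 0).connectedTwoPoint k s s (thetaTest 4 0)
          (timeShiftTest 4 ((j : ℝ) * reg.a k) 0)‖ :=
  ⟨1, one_pos, Eventually.of_forall fun k m _ j _ => by simp⟩

/-- **Negation unfolded** (the refuter's target): `reg` is NOT non-decoupled iff for some compact `K`
of positive tuples, non-null species `s`, real `g` in a positive-time slab and physical time `T`,
EVERY `c > 0` is beaten for infinitely many `k`: some `m ∈ K` and some commensurate translation
`j a_k ≤ T` have `‖C_k(m; Θg, τ_{j a_k} g)‖ < c ‖C_k(m; Θg, g)‖` (ratio collapse). [folklore] -/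
theorem not_isNonDecoupled_iff (reg : QCDRegularisation Nf) :
    ¬ reg.IsNonDecoupled ↔
      ∃ K : Set (Fin Nf → ℝ), IsCompact K ∧ K ⊆ {m | ∀ fl, 0 < m fl} ∧ ∃ s : QCDField Nf,
        (∀ fl, s ≠ QCDField.pseudoIm fl fl) ∧ ∃ t₁ t₂ : ℝ, 0 < t₁ ∧
          ∃ g : 𝓢(EuclideanSpace ℝ (Fin 4), ℝ), tsupport g ⊆ timeSlab 4 t₁ t₂ ∧ ∃ T : ℝ,
            ∀ c > (0 : ℝ), ∃ᶠ k in atTop, ∃ m ∈ K, ∃ j : ℕ, (j : ℝ) * reg.a k ≤ T ∧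
              ‖(reg.scheme m 1 0).connectedTwoPoint k s s (thetaTest 4 g)
                  (timeShiftTest 4 ((j : ℝ) * reg.a k) g)‖ <
                c * ‖(reg.scheme m 1 0).connectedTwoPoint k s s (thetaTest 4 g) g‖ := by
  simp only [IsNonDecoupled, not_forall, not_exists, not_and, Filter.not_eventually, not_le,
    exists_prop, gt_iff_lt]

/-- **Ratio collapse refutes non-decoupling** (one direction of `not_isNonDecoupled_iff`, with the
witnesses as arguments). [folklore] -/
theorem not_isNonDecoupled_of_ratio_collapse (reg : QCDRegularisation Nf) {K : Set (Fin Nf → ℝ)}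
    (hK : IsCompact K) (hKpos : K ⊆ {m | ∀ fl, 0 < m fl}) {s : QCDField Nf}
    (hs : ∀ fl, s ≠ QCDField.pseudoIm fl fl) {t₁ t₂ : ℝ} (ht₁ : 0 < t₁)
    {g : 𝓢(EuclideanSpace ℝ (Fin 4), ℝ)} (hg : tsupport g ⊆ timeSlab 4 t₁ t₂) {T : ℝ}
    (h : ∀ c > (0 : ℝ), ∃ᶠ k in atTop, ∃ m ∈ K, ∃ j : ℕ, (j : ℝ) * reg.a k ≤ T ∧
      ‖(reg.scheme m 1 0).connectedTwoPoint k s s (thetaTest 4 g)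
          (timeShiftTest 4 ((j : ℝ) * reg.a k) g)‖ <
        c * ‖(reg.scheme m 1 0).connectedTwoPoint k s s (thetaTest 4 g) g‖) :
    ¬ reg.IsNonDecoupled :=
  (not_isNonDecoupled_iff reg).2 ⟨K, hK, hKpos, s, hs, t₁, t₂, ht₁, g, hg, T, h⟩

/-- **The decoupled class fails `IsNonDecoupled`.** If for one compact `K` of positive tuples, one
non-null species `s`, one real `g` in a positive-time slab, some `m₀ ∈ K` and some `μ₀ > 0` the bare
connected two-point function decays under lattice time translations at rate `μ₀` in LATTICE units —
`‖C_k(m₀; Θg, τ_{j a_k} g)‖ ≤ C e^{−μ₀ j} ‖C_k(m₀; Θg, g)‖` for all large `k` and all `j : ℕ` (channel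
mass `≥ μ₀` in lattice units: the `e^{−mt}` law of Montvay–Münster (7.29) with `m ≥ μ₀`) — while
`C_k(m₀; Θg, g) ≠ 0` for infinitely many `k`, then `reg` is decoupled: a physical translation `T = 1`
is `j_k = ⌊1/a_k⌋ → ∞` lattice units (`a_k → 0`), and `C e^{−μ₀ j_k} → 0` beats every `c > 0`.
[cite: MontvayMunster1994, §7.1 (7.29)] -/
theorem not_isNonDecoupled_of_latticeUnitGap (reg : QCDRegularisation Nf) {K : Set (Fin Nf → ℝ)}
    (hK : IsCompact K) (hKpos : K ⊆ {m | ∀ fl, 0 < m fl}) {s : QCDField Nf}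
    (hs : ∀ fl, s ≠ QCDField.pseudoIm fl fl) {t₁ t₂ : ℝ} (ht₁ : 0 < t₁)
    {g : 𝓢(EuclideanSpace ℝ (Fin 4), ℝ)} (hg : tsupport g ⊆ timeSlab 4 t₁ t₂) {m₀ : Fin Nf → ℝ}
    (hm₀ : m₀ ∈ K) {C μ₀ : ℝ} (hμ₀ : 0 < μ₀)
    (hdecay : ∀ᶠ k in atTop, ∀ j : ℕ,
      ‖(reg.scheme m₀ 1 0).connectedTwoPoint k s s (thetaTest 4 g)
          (timeShiftTest 4 ((j : ℝ) * reg.a k) g)‖ ≤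
        C * Real.exp (-(μ₀ * j)) * ‖(reg.scheme m₀ 1 0).connectedTwoPoint k s s (thetaTest 4 g) g‖)
    (hlive : ∃ᶠ k in atTop, (reg.scheme m₀ 1 0).connectedTwoPoint k s s (thetaTest 4 g) g ≠ 0) :
    ¬ reg.IsNonDecoupled := by
  intro h
  obtain ⟨c, hc, hclause⟩ := h K hK hKpos s hs t₁ t₂ ht₁ g hg 1
  -- the number of lattice units in one physical time unit diverges
  have hinv : Tendsto (fun k => (reg.a k)⁻¹) atTop atTop :=
    tendsto_inv_nhdsGT_zero.comp
      (tendsto_nhdsWithin_iff.2 ⟨reg.tendsto_a, Eventually.of_forall fun k => reg.a_pos k⟩)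
  have hfloor : Tendsto (fun k => ⌊(reg.a k)⁻¹⌋₊) atTop atTop :=
    tendsto_nat_floor_atTop.comp hinv
  have hexp : Tendsto (fun k => C * Real.exp (-(μ₀ * (⌊(reg.a k)⁻¹⌋₊ : ℕ)))) atTop (𝓝 (C * 0)) :=
    tendsto_const_nhds.mul (Real.tendsto_exp_neg_atTop_nhds_zero.comp
      ((tendsto_natCast_atTop_atTop.comp hfloor).const_mul_atTop hμ₀))
  rw [mul_zero] at hexp
  obtain ⟨k, hne, hk, hdk, hsk⟩ :=
    (hlive.and_eventually (hclause.and (hdecay.and (hexp.eventually_lt_const hc)))).exists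
  have ha := reg.a_pos k
  have hjT : ((⌊(reg.a k)⁻¹⌋₊ : ℕ) : ℝ) * reg.a k ≤ 1 :=
    calc ((⌊(reg.a k)⁻¹⌋₊ : ℕ) : ℝ) * reg.a k ≤ (reg.a k)⁻¹ * reg.a k :=
          mul_le_mul_of_nonneg_right (Nat.floor_le (inv_nonneg.2 ha.le)) ha.le
      _ = 1 := inv_mul_cancel₀ ha.ne'
  have hpos : 0 < ‖(reg.scheme m₀ 1 0).connectedTwoPoint k s s (thetaTest 4 g) g‖ :=
    norm_pos_iff.2 hne
  exact lt_irrefl _ (((hk m₀ hm₀ _ hjT).trans (hdk _)).trans_lt (mul_lt_mul_of_pos_right hsk hpos))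

end QCDRegularisation

end Literature.MathematicalPhysics.QuantumFieldTheory

end
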